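import Literature.NumberTheory.GaloisRepresentations.EisensteinSexticHeckeCharacterOdd
import Literature.NumberTheory.GaloisRepresentations.EisensteinSexticHeckeCharacter
import Literature.NumberTheory.GaloisRepresentations.HeckeCharacterOfGrossencharakterRigidity
import Literature.NumberTheory.GaloisRepresentations.EisensteinSexticRamification
import HarnessLib

/-!
# The good-at-`2` sextic Größencharakter `psiOdd u` (mod `9u`) and `psi (16u)` (mod `576u`) define THE SAME Hecke character of `ℚ(ω)`

Topic `Literature/NumberTheory/GaloisRepresentations`, namespace `Literature.NumberTheory.GaloisRepresentations.EisensteinSextic` (§2–§3; §1 is `HeckeCharacterOfGrossencharakterRigidity`).  THEOREMS ONLY (no definition, no instance, no named fact, no `sorry`).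

Ireland–Rosen Ch. 18 §7 attaches to `y² = x³ + D` the Hecke character `χ(𝔭) = (4D/π)₆‾ π` «for the modulus `12D`» and remarks that the
conductor may be smaller; for `D = 16u` with `u ≡ 1 (mod 4)` (the curves with good reduction at `2`) the tree carries two ideal-theoretic
avatars of this character: `EisensteinSextic.psi hζ (16u) e` modulo `(36·16u)` (`EisensteinSexticHeckeCharacter`, vanishing at the prime `2`)
and `EisensteinSextic.psiOdd hζ u e` modulo the odd ideal `(9u)` (`EisensteinSexticHeckeCharacterOdd`, quadratic part `(N𝔭/|u|)`, alive at
`2`).  They AGREE at every prime `𝔭 ∤ 6u` — `(16u/N𝔭) = (u/N𝔭) = (N𝔭/|u|)` by quadratic reciprocity for `u ≡ 1 (4)` (either sign of `u`)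
at the odd number `N𝔭`, and `(64u/𝔭)₃ = (u/𝔭)₃` since `64 = 4³` — hence, by «multiplicity one for `GL(1)`» (a Hecke character is determined
by almost all of its values at uniformizers, Cassels–Fröhlich VII Prop. 4.1; tree `HeckeCharacter.ext_of_eventually_valueAtUniformizer_eq`),
the idelic Hecke characters `heckeOfGross` of the two data (Neukirch VII (6.14)) COINCIDE.  Consequently every intrinsic property —
ramification at a place, values at uniformizers — transfers between the two presentations; in particular the ramification of the
`(36k)`-presentation above the odd primes of `k = 16u` (the witnesses of `EisensteinSexticRamification`, seat w3) IS the ramification of the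
`(9u)`-presentation needed by Deuring's theorem for `y² = x³ + 16u` at its bad primes `p ∣ u`, `p ≥ 5`.

* §1 = the file `HeckeCharacterOfGrossencharakterRigidity` (general `K`): `heckeOfGross_eq_of_eventually_eq`, `heckeOfGross_eq_of_forall_not_mem`;
* §2 `jacobiSym_eq_jacobiSym_natAbs_of_mod_four_eq_one` (`(u/n) = (n/|u|)`, `u ≡ 1 (4)`, `n` odd), `jacobiSym_sixteen_mul`,
  `odd_absNorm_of_two_not_mem`, `cubicResidueSymbol_sixtyfour_mul`, ★ `psiOdd_eq_psi_sixteen_mul` (`𝔭 ∤ 6u`);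
* §3 ★★ `heckeOfGross_psiOdd_eq_heckeOfGross_psi` — THE SAME HECKE CHARACTER; corollaries `isUnramifiedAt_heckeOfGross_psiOdd_iff`,
  `not_isUnramifiedAt_heckeOfGross_psiOdd_of_psi` (ramification transfers from the `(36k)`-presentation, `k = 16u`);
* §4 (appended) ★★ `not_isUnramifiedAt_heckeOfGross_psiOdd_of_dvd` — `heckeOfGross (psiOdd u)` is RAMIFIED above every prime `p ≠ 3`
  of `u` (the witnesses of `EisensteinSexticRamification`, seat w3, transferred): the ramification clause of Deuring's theorem for
  `y² = x³ + 16u` at its bad primes `p ≥ 5`.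

Filed for the row `j = 0` of `Deuring_exists_heckeCharacter_of_maximalCM` (route `BiquadraticEisensteinDescent` of `Summits/BirchSwinnertonDyer`,
crux 21341, cell `bsd-wall`, seat w4 g18).  Nothing about BSD is proved here; no modularity is used.

## References
* K. Ireland, M. Rosen, *A Classical Introduction to Modern Number Theory*, 2nd ed., GTM 84 (1990), Ch. 5 §2 Thm. 1 and Prop. 5.2.2 (Jacobi
  reciprocity), Ch. 9 §3 Prop. 9.3.3, Ch. 18 §4 Theorem 5, §7. [IrelandRosen1990]
* J. W. S. Cassels, A. Fröhlich (eds.), *Algebraic Number Theory* (1967), Ch. VII (Tate) §4 Prop. 4.1. [CasselsFrohlichANT1967]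
* J. Neukirch, *Algebraic Number Theory* (1999), Ch. VII §6 Cor. (6.14). [NeukirchANT1999]
* J. H. Silverman, *Advanced Topics in the Arithmetic of Elliptic Curves* (1994), II Thm. 9.2, Thm. 10.5. [SilvermanATAEC1994]

## Mathlib / tree search
Tree: `heckeOfGross`, `heckeOfGross_valueAtUniformizer` (`HeckeCharacterOfGrossencharakter`); `HeckeCharacter.ext_of_eventually_valueAtUniformizer_eq`
(`HeckeCharacterWeakApproximation`); `EisensteinSextic.{psi, psi_of_not_mem, modulus, modulus_ne_bot, isGrossencharakter_psi_one_zero,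
not_mem_of_six_mul_not_mem}` (`EisensteinSexticHeckeCharacter`); `EisensteinSextic.{psiOdd, psiOdd_of_not_mem, modulusOdd, modulusOdd_ne_bot,
isGrossencharakter_psiOdd_one_zero}` (`EisensteinSexticHeckeCharacterOdd`); `EisensteinSextic.{coe_cubicLoc_of_not_mem, not_dvd_absNorm_of_isCoprime}`
(`EisensteinSexticPrimes`); `cubicResidueSymbol_mul`, `cubicResidueSymbol_spec` (`CubicResidueSymbol`).  Mathlib: `jacobiSym.{mul_left, neg, at_four,
quadratic_reciprocity_one_mod_four, quadratic_reciprocity_one_mod_four', quadratic_reciprocity_three_mod_four}`, `ZMod.χ₄_nat_one_mod_four`,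
`ZMod.χ₄_nat_three_mod_four`, `Ideal.finite_factors`, `Filter.eventually_cofinite`.
-/

noncomputable section

open NumberField IsDedekindDomain IsDedekindDomain.HeightOneSpectrum Filter
open scoped NumberTheorySymbols ComplexConjugate

namespace Literature.NumberTheory.GaloisRepresentations

/-! (§1, the general rigidity lemma `heckeOfGross_eq_of_eventually_eq`, is the file `HeckeCharacterOfGrossencharakterRigidity`.) -/

namespace EisensteinSextic

/-! ### §2 `psiOdd u` and `psi (16u)` agree off `6u` -/

section Agree

/-- **Jacobi reciprocity for `u ≡ 1 (mod 4)` of either sign**: `(u/n) = (n/|u|)` for every odd `n` — for `u > 0` this is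
`(u/n) = (n/u)`; for `u < 0`, `|u| ≡ 3 (4)` and `(−1/n)(|u|/n) = (n/|u|)` in both cases `n ≡ 1, 3 (4)`.
[cite: IrelandRosen1990, Ch. 5 §2, Theorem 1 and Prop. 5.2.2] -/
theorem jacobiSym_eq_jacobiSym_natAbs_of_mod_four_eq_one {u : ℤ} (hu : u % 4 = 1) {n : ℕ} (hn : Odd n) :
    J(u | n) = J((n : ℤ) | u.natAbs) := by
  rcases Int.natAbs_eq u with h | h
  · -- `u ≥ 0`
    have hu' : u.natAbs % 4 = 1 := by omega
    rw [h, Int.natAbs_natCast]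
    exact jacobiSym.quadratic_reciprocity_one_mod_four hu' hn
  · -- `u < 0`, `|u| ≡ 3 (mod 4)`
    have hu' : u.natAbs % 4 = 3 := by omega
    conv_lhs => rw [h]
    rw [jacobiSym.neg _ hn]
    rcases Nat.odd_mod_four_iff.mp (Nat.odd_iff.mp hn) with h1 | h3
    · rw [ZMod.χ₄_nat_one_mod_four h1, one_mul]
      exact jacobiSym.quadratic_reciprocity_one_mod_four' (Nat.odd_iff.mpr (by omega)) h1
    · rw [ZMod.χ₄_nat_three_mod_four h3, jacobiSym.quadratic_reciprocity_three_mod_four hu' h3]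
      ring

/-- `(16u/n) = (n/|u|)` for `u ≡ 1 (mod 4)` and `n` odd (`(16/n) = (4/n)² = 1`). [cite: IrelandRosen1990, Ch. 5 §2 Prop. 5.2.2; Ch. 18 §7] -/
theorem jacobiSym_sixteen_mul {u : ℤ} (hu : u % 4 = 1) {n : ℕ} (hn : Odd n) :
    J(16 * u | n) = J((n : ℤ) | u.natAbs) := by
  rw [jacobiSym.mul_left, show (16 : ℤ) = 4 * 4 by norm_num, jacobiSym.mul_left, jacobiSym.at_four hn, one_mul, one_mul,
    jacobiSym_eq_jacobiSym_natAbs_of_mod_four_eq_one hu hn]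

variable {K : Type*} [Field K] [NumberField K]

/-- **`N𝔭` is odd for `𝔭 ∤ 2`** (`𝔭` maximal and `2 ∉ 𝔭` give `𝔭 + (2) = 1`, so `2 ∤ N𝔭`, `not_dvd_absNorm_of_isCoprime`).
[cite: NeukirchANT1999, Ch. I §8 (primes above a rational prime)] -/
theorem odd_absNorm_of_two_not_mem {v : HeightOneSpectrum (𝓞 K)} (h2 : (2 : 𝓞 K) ∉ v.asIdeal) : Odd (Ideal.absNorm v.asIdeal) := by
  have hcop : IsCoprime v.asIdeal (Ideal.span {((2 : ℕ) : 𝓞 K)}) := by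
    rw [Ideal.isCoprime_iff_sup_eq]
    by_contra hne
    have hle : v.asIdeal ≤ v.asIdeal ⊔ Ideal.span {((2 : ℕ) : 𝓞 K)} := le_sup_left
    have heq := v.isMaximal.eq_of_le hne hle
    apply h2
    rw [heq]
    exact Ideal.mem_sup_right (Ideal.mem_span_singleton_self _)
  have h := not_dvd_absNorm_of_isCoprime v.ne_bot Nat.prime_two hcop
  exact Nat.odd_iff.mpr (Nat.two_dvd_ne_zero.mp h)

variable {ζ : 𝓞 K} (hζ : IsPrimitiveRoot ζ 3)

include hζ in
/-- **`(64u/𝔭)₃ = (u/𝔭)₃` at `𝔭 ∤ 6`** (`64 = 4³` and the cubic residue symbol is a multiplicative cube root of unity).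
[cite: IrelandRosen1990, Ch. 9 §3 Prop. 9.3.3 (a), (b)] -/
theorem cubicResidueSymbol_sixtyfour_mul (u : 𝓞 K) {v : HeightOneSpectrum (𝓞 K)} (h2 : (2 : 𝓞 K) ∉ v.asIdeal)
    (h3 : (3 : 𝓞 K) ∉ v.asIdeal) :
    cubicResidueSymbol v (Ideal.Quotient.mk v.asIdeal (64 * u)) = cubicResidueSymbol v (Ideal.Quotient.mk v.asIdeal u) := by
  have h4 : Ideal.Quotient.mk v.asIdeal (4 : 𝓞 K) ≠ 0 := by
    rw [Ne, Ideal.Quotient.eq_zero_iff_mem, show (4 : 𝓞 K) = 2 * 2 by norm_num]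
    exact fun h => (v.isPrime.mem_or_mem h).elim h2 h2
  have hcube := (cubicResidueSymbol_spec hζ h3 h4).1
  rw [show (64 : 𝓞 K) * u = 4 * (4 * (4 * u)) by ring, map_mul, cubicResidueSymbol_mul hζ, map_mul, cubicResidueSymbol_mul hζ,
    map_mul, cubicResidueSymbol_mul hζ, ← mul_assoc, ← mul_assoc]
  have : cubicResidueSymbol v (Ideal.Quotient.mk v.asIdeal 4) * cubicResidueSymbol v (Ideal.Quotient.mk v.asIdeal 4) *
      cubicResidueSymbol v (Ideal.Quotient.mk v.asIdeal 4) = cubicResidueSymbol v (Ideal.Quotient.mk v.asIdeal 4) ^ 3 := by ring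
  rw [this, hcube, one_mul]

variable [IsCyclotomicExtension {3} ℚ K]

/-- ★ **`psiOdd u` and `psi (16u)` agree at every prime `𝔭 ∤ 6u`** (`u ≡ 1 (mod 4)`): `(16u/N𝔭) = (N𝔭/|u|)` (`N𝔭` is odd),
`(4·16u/𝔭)₃ = (u/𝔭)₃` (`64 = 4³`), and the generator factor `e(ϖ_𝔭)` is common.  Ireland–Rosen's `χ` for `D = 16u` read modulo `(9u)`.
[cite: IrelandRosen1990, Ch. 18 §4 Theorem 5 and §7] -/
theorem psiOdd_eq_psi_sixteen_mul {u : ℤ} (hu : u % 4 = 1) (e : K →+* ℂ) {v : HeightOneSpectrum (𝓞 K)}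
    (h6u : ((6 * u : ℤ) : 𝓞 K) ∉ v.asIdeal) : psiOdd hζ u e v = psi hζ (16 * u) e v := by
  obtain ⟨h2, h3, h4u⟩ := not_mem_of_six_mul_not_mem (K := K) h6u
  -- `6·16u ∉ 𝔭`, `3u ∉ 𝔭`, `u ∉ 𝔭`, `64u ∉ 𝔭`
  have h96 : ((6 * (16 * u) : ℤ) : 𝓞 K) ∉ v.asIdeal := by
    intro h
    have : ((6 * (16 * u) : ℤ) : 𝓞 K) = (4 * 4) * ((6 * u : ℤ) : 𝓞 K) := by push_cast; ring
    rw [this, show (4 : 𝓞 K) = 2 * 2 by norm_num] at h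
    rcases v.isPrime.mem_or_mem h with h | h
    · rcases v.isPrime.mem_or_mem h with h | h <;> rcases v.isPrime.mem_or_mem h with h | h <;> exact h2 h
    · exact h6u h
  have h3u : ((3 * u : ℤ) : 𝓞 K) ∉ v.asIdeal := by
    intro h
    apply h6u
    have : ((6 * u : ℤ) : 𝓞 K) = 2 * ((3 * u : ℤ) : 𝓞 K) := by push_cast; ring
    rw [this]; exact v.asIdeal.mul_mem_left _ h
  have hu' : ((u : ℤ) : 𝓞 K) ∉ v.asIdeal := by
    intro h
    apply h3u
    have : ((3 * u : ℤ) : 𝓞 K) = 3 * ((u : ℤ) : 𝓞 K) := by push_cast; ring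
    rw [this]; exact v.asIdeal.mul_mem_left _ h
  have h64 : ((4 * (16 * u) : ℤ) : 𝓞 K) ∉ v.asIdeal := by
    intro h
    have : ((4 * (16 * u) : ℤ) : 𝓞 K) = (4 * 4) * ((4 * u : ℤ) : 𝓞 K) := by push_cast; ring
    rw [this, show (4 : 𝓞 K) = 2 * 2 by norm_num] at h
    rcases v.isPrime.mem_or_mem h with h | h
    · rcases v.isPrime.mem_or_mem h with h | h <;> rcases v.isPrime.mem_or_mem h with h | h <;> exact h2 h
    · exact h4u h
  have h64cast : ((4 * (16 * u) : ℤ) : 𝓞 K) = 64 * ((u : ℤ) : 𝓞 K) := by push_cast; ring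
  -- quadratic part by reciprocity at the odd number `N𝔭`, cubic part by `64 = 4³`, generator part common
  rw [psiOdd_of_not_mem hζ e h3u, psi_of_not_mem hζ e h96, jacobiSym_sixteen_mul hu (odd_absNorm_of_two_not_mem h2),
    coe_cubicLoc_of_not_mem hζ e hu' h3, coe_cubicLoc_of_not_mem hζ e h64 h3, h64cast,
    cubicResidueSymbol_sixtyfour_mul hζ _ h2 h3]

end Agree

/-! ### §3 The two presentations define the same Hecke character; ramification transfers -/

section Transfer

variable {K : Type*} [Field K] [NumberField K] {ζ : 𝓞 K} (hζ : IsPrimitiveRoot ζ 3) [IsCyclotomicExtension {3} ℚ K]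

/-- ★★ **THE SAME HECKE CHARACTER.**  For `u ≠ 0` (and `k = 16u ≠ 0`, any proof), `u ≡ 1 (mod 4)`: the Hecke character of `ℚ(ω)` attached (Neukirch VII (6.14)) to the
Größencharakter `psiOdd u` modulo `(9u)` EQUALS the one attached to `psi (16u)` modulo `(36·16u)` — they agree at every `𝔭 ∤ 6u`
(`psiOdd_eq_psi_sixteen_mul`) and a Hecke character is determined by almost all `ω(ϖ_𝔭)` (`heckeOfGross_eq_of_forall_not_mem`).  This is
Ireland–Rosen's remark that `χ` «for the modulus `12D`» may have smaller conductor, made precise for `D = 16u`.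
[cite: IrelandRosen1990, Ch. 18 §7] [cite: CasselsFrohlichANT1967, Ch. VII §4 Prop. 4.1 (proof)] [cite: NeukirchANT1999, Ch. VII §6 Cor. (6.14)] -/
theorem heckeOfGross_psiOdd_eq_heckeOfGross_psi {u : ℤ} (hu : u ≠ 0) (hk : 16 * u ≠ 0) (hu4 : u % 4 = 1) (w₀ : InfinitePlace K) :
    heckeOfGross (modulusOdd_ne_bot (K := K) hu) (isGrossencharakter_psiOdd_one_zero hζ hu w₀) =
      heckeOfGross (modulus_ne_bot (K := K) hk) (isGrossencharakter_psi_one_zero hζ hk w₀) := by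
  refine heckeOfGross_eq_of_forall_not_mem _ _ _ _ (m := ((6 * u : ℤ) : 𝓞 K)) (by exact_mod_cast mul_ne_zero (by norm_num) hu)
    fun v hv => psiOdd_eq_psi_sixteen_mul hζ hu4 w₀.embedding hv

/-- **Ramification of the good-at-`2` character is ramification of the `(36k)`-presentation, `k = 16u`** (intrinsic to the common
Hecke character). [cite: CasselsFrohlichANT1967, Ch. VII §4 Prop. 4.1] [cite: IrelandRosen1990, Ch. 18 §7] -/
theorem isUnramifiedAt_heckeOfGross_psiOdd_iff {u : ℤ} (hu : u ≠ 0) (hk : 16 * u ≠ 0) (hu4 : u % 4 = 1) (w₀ : InfinitePlace K)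
    (w : HeightOneSpectrum (𝓞 K)) :
    (heckeOfGross (modulusOdd_ne_bot (K := K) hu) (isGrossencharakter_psiOdd_one_zero hζ hu w₀)).IsUnramifiedAt w ↔
      (heckeOfGross (modulus_ne_bot (K := K) hk)
        (isGrossencharakter_psi_one_zero hζ hk w₀)).IsUnramifiedAt w := by
  rw [heckeOfGross_psiOdd_eq_heckeOfGross_psi hζ hu hk hu4 w₀]

/-- ★ **Ramification transfer**: if the `(36k)`-presentation of the character of `y² = x³ + 16u` (`k = 16u`) is ramified at `w`, so is
the `(9u)`-presentation `heckeOfGross (psiOdd u)`.  With the witnesses of `EisensteinSexticRamification` at the primes `w ∣ p`, `p ∣ u`,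
`p ≠ 3` (seat w3) this is the ramification clause of Deuring's theorem for the good-at-`2` sextic twists at their bad primes `p ≥ 5`.
[cite: IrelandRosen1990, Ch. 18 §7] [cite: SilvermanATAEC1994, Ch. II Thm. 9.2 (b), Thm. 10.5] -/
theorem not_isUnramifiedAt_heckeOfGross_psiOdd_of_psi {u : ℤ} (hu : u ≠ 0) (hk : 16 * u ≠ 0) (hu4 : u % 4 = 1) (w₀ : InfinitePlace K)
    {w : HeightOneSpectrum (𝓞 K)}
    (h : ¬ (heckeOfGross (modulus_ne_bot (K := K) hk)
      (isGrossencharakter_psi_one_zero hζ hk w₀)).IsUnramifiedAt w) :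
    ¬ (heckeOfGross (modulusOdd_ne_bot (K := K) hu) (isGrossencharakter_psiOdd_one_zero hζ hu w₀)).IsUnramifiedAt w := by
  rwa [isUnramifiedAt_heckeOfGross_psiOdd_iff hζ hu hk hu4 w₀]

/-- **Value transfer**: the two presentations have the same values at uniformizers (everywhere), e.g. `ω(ϖ_{(2)}) = psiOdd u (2)`
can be read on either side. [cite: CasselsFrohlichANT1967, Ch. VII §4 Prop. 4.1] [cite: NeukirchANT1999, Ch. VII §6 Cor. (6.14)] -/
theorem valueAtUniformizer_heckeOfGross_psiOdd_eq {u : ℤ} (hu : u ≠ 0) (hk : 16 * u ≠ 0) (hu4 : u % 4 = 1) (w₀ : InfinitePlace K)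
    (w : HeightOneSpectrum (𝓞 K)) :
    (heckeOfGross (modulusOdd_ne_bot (K := K) hu) (isGrossencharakter_psiOdd_one_zero hζ hu w₀)).valueAtUniformizer w =
      (heckeOfGross (modulus_ne_bot (K := K) hk)
        (isGrossencharakter_psi_one_zero hζ hk w₀)).valueAtUniformizer w := by
  rw [heckeOfGross_psiOdd_eq_heckeOfGross_psi hζ hu hk hu4 w₀]

end Transfer

/-! ### §4 Ramification of the good-at-`2` character above the odd primes of `u` (transfer of `EisensteinSexticRamification`) -/

section RamificationOdd

variable {K : Type} [Field K] [NumberField K] {ζ : 𝓞 K} (hζ : IsPrimitiveRoot ζ 3) [IsCyclotomicExtension {3} ℚ K]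

/-- ★★ **The character of `y² = x³ + 16u` (`u ≡ 1 (mod 4)`) is RAMIFIED above every prime `p ≠ 3` of `u`** — in the `(9u)`-presentation
`heckeOfGross (psiOdd u)`: these are exactly the bad primes `p ≥ 5` of the good-at-`2` sextic twists (`SexticTwist.dvd_conductorNorm_iff`),
where Deuring's theorem wants the Euler factor of `L(s, ψ)` to be `1`.  Proof: the `(36k)`-presentation with `k = 16u` is ramified there
(`not_isUnramifiedAt_heckeOfGross_psi_of_ne_three`, the witnesses of `EisensteinSexticRamification`; `p ≠ 2` since `u` is odd) and the two
presentations are the same Hecke character (`heckeOfGross_psiOdd_eq_heckeOfGross_psi`).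
[cite: IrelandRosen1990, Ch. 18 §7] [cite: SilvermanATAEC1994, Ch. II Thm. 9.2 (b), Thm. 10.5] -/
theorem not_isUnramifiedAt_heckeOfGross_psiOdd_of_dvd {u : ℤ} (hu : u ≠ 0) (hk : 16 * u ≠ 0) (hu4 : u % 4 = 1)
    (h6 : ∀ q : ℕ, q.Prime → ¬ (q : ℤ) ^ 6 ∣ 16 * u) (w₀ : InfinitePlace K) {p : ℕ} (hp : p.Prime) (hp3 : p ≠ 3)
    (hpu : (p : ℤ) ∣ u) {w : HeightOneSpectrum (𝓞 K)} (hpw : (p : 𝓞 K) ∈ w.asIdeal) :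
    ¬ (heckeOfGross (modulusOdd_ne_bot (K := K) hu) (isGrossencharakter_psiOdd_one_zero hζ hu w₀)).IsUnramifiedAt w := by
  refine not_isUnramifiedAt_heckeOfGross_psiOdd_of_psi hζ hu hk hu4 w₀
    (not_isUnramifiedAt_heckeOfGross_psi_of_ne_three hζ hk h6 w₀ hp hp3 hpw ?_ ?_)
  · -- `(36·16u) ≤ 𝔭_w`: `6·16u = (96 u/p)·p ∈ 𝔭_w`
    rw [modulus_le_iff]
    obtain ⟨m, hm⟩ := hpu
    have : ((6 * (16 * u) : ℤ) : 𝓞 K) = ((96 * m : ℤ) : 𝓞 K) * (p : 𝓞 K) := by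
      rw [hm]; push_cast; ring
    rw [this]
    exact w.asIdeal.mul_mem_left _ hpw
  · -- `p ≠ 2` (`u` is odd), so the good-at-`2` proviso is vacuous
    rintro rfl
    exfalso
    have h2u : (2 : ℤ) ∣ u := by exact_mod_cast hpu
    omega

end RamificationOdd


end EisensteinSextic

end Literature.NumberTheory.GaloisRepresentations

end
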